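import Summits.AtomisticToContinuum.Crystallization.Theorems.PalmUnimodularRigidityShellsToBarlowChartTransportSteps1
import Summits.AtomisticToContinuum.Crystallization.Theorems.PalmUnimodularRigidityShellsToBarlowChartTransportSteps2
import Summits.AtomisticToContinuum.Crystallization.Theorems.PalmUnimodularRigidityShellsToBarlowChartTransportSteps3
import Summits.AtomisticToContinuum.Crystallization.Theorems.PalmUnimodularRigidityShellsToBarlowChartTransportSteps4
import Summits.AtomisticToContinuum.Crystallization.Theorems.PalmUnimodularRigidityShellsToBarlowChartTransportSteps5
import Summits.AtomisticToContinuum.Crystallization.Theorems.PalmUnimodularRigidityShellsToBarlowChartTransportSteps6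
import Summits.AtomisticToContinuum.Crystallization.Theorems.PalmUnimodularRigidityShellsToBarlowChartTransportComm1
import Summits.AtomisticToContinuum.Crystallization.Theorems.PalmUnimodularRigidityShellsToBarlowChartTransportLayerZero

/-!
# Line `develop-the-model-growth-descent` (crux `ShellsToBarlowChart`, stmt-AtomisticToContinuum-9227): `zIter` lemmas, lines and the base layer

Helper lemmas for `stub_transportSystem` (the geometric half of the line): frames `⟨x, t₁, t₂, U⟩`
read in the integer charts `IsZChart` of a good-shell configuration, their transports and the
coherence of the resulting development `frameAt`.  The only metric inputs are the chart transfer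
lemma and `bond_nb_iff`; everything else is label combinatorics in `ℤ³` (pattern facts
`TransportPatterns*`).  All `[folklore]` (HalesDSP2012 §1.3 for the two kissing patterns).
-/

noncomputable section

namespace Summit.AtomisticToContinuum.Crystallization.Theorems.PalmUnimodularRigidityShellsToBarlowChart

open Literature.Geometry.DiscreteGeometry Literature.MathematicalPhysics.StatisticalMechanics
open Summit.AtomisticToContinuum.Crystallization.Theorems.ShellsToBarlowChartNegative

variable {S : Set (EuclideanSpace ℝ (Fin 3))} {ac : (EuclideanSpace ℝ (Fin 3)) → ℝ} {Pc : (EuclideanSpace ℝ (Fin 3)) → Finset (Fin 3 → ℤ)}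
  {Ac : (EuclideanSpace ℝ (Fin 3)) → ((EuclideanSpace ℝ (Fin 3)) →ₗᵢ[ℝ] (EuclideanSpace ℝ (Fin 3)))} {nb : (EuclideanSpace ℝ (Fin 3)) → (Fin 3 → ℤ) → (EuclideanSpace ℝ (Fin 3))}

/-- `zIter` at a successor of a natural number. [folklore] -/
theorem zIter_natSucc {α : Type} (fwd bwd : α → α) (n : ℕ) (a : α) : zIter fwd bwd ((n : ℤ) + 1) a = fwd (zIter fwd bwd (n : ℤ) a) := by
  show fwd^[n + 1] a = fwd (fwd^[n] a)
  exact Function.iterate_succ_apply' fwd n a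

/-- `zIter` at `−(n+1)`. [folklore] -/
theorem zIter_negSucc' {α : Type} (fwd bwd : α → α) (n : ℕ) (a : α) :
    zIter fwd bwd (-((n : ℤ) + 1)) a = bwd (zIter fwd bwd (-(n : ℤ)) a) := by
  cases n with
  | zero => rfl
  | succ m =>
    show bwd^[m + 2] a = bwd (bwd^[m + 1] a)
    exact Function.iterate_succ_apply' bwd (m + 1) a

/-- Every integer is a natural number or `−(n+1)`. [folklore] -/
theorem int_cases (k : ℤ) : (∃ n : ℕ, k = n) ∨ (∃ n : ℕ, k = -((n : ℤ) + 1)) := by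
  rcases Int.eq_nat_or_neg k with ⟨n, rfl | rfl⟩
  · exact Or.inl ⟨n, rfl⟩
  · cases n with
    | zero => exact Or.inl ⟨0, by simp⟩
    | succ m => exact Or.inr ⟨m, by push_cast; ring⟩

/-- **The I-line through an admissible frame.**  Iterating `I` / `I⁻¹` from a valid frame of
parity `+1` in the base regime gives valid frames of parity `+1` in the base regime, consecutive
ones related by `I`. [folklore] -/
theorem line_I (hch : ∀ z ∈ S, IsZChart S z (ac z) (Pc z) (Ac z) (nb z)) {g₀ : ZFrame}
    (h₀ : IsFrame (Pc g₀.pt) g₀.t₁ g₀.t₂ g₀.U) (h₀S : g₀.pt ∈ S) (h₀p : frameParity g₀.t₁ g₀.t₂ g₀.U = 1)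
    (h₀A : (∀ z ∈ S, Pc z = fcc3Int) ∨ Pc g₀.pt = hcpInt) :
    ∀ k : ℤ, IsFrame (Pc (zIter (Istep Pc nb) (IinvStep Pc nb) k g₀).pt) (zIter (Istep Pc nb) (IinvStep Pc nb) k g₀).t₁
        (zIter (Istep Pc nb) (IinvStep Pc nb) k g₀).t₂ (zIter (Istep Pc nb) (IinvStep Pc nb) k g₀).U ∧
      (zIter (Istep Pc nb) (IinvStep Pc nb) k g₀).pt ∈ S ∧
      frameParity (zIter (Istep Pc nb) (IinvStep Pc nb) k g₀).t₁ (zIter (Istep Pc nb) (IinvStep Pc nb) k g₀).t₂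
        (zIter (Istep Pc nb) (IinvStep Pc nb) k g₀).U = 1 ∧
      ((∀ z ∈ S, Pc z = fcc3Int) ∨ Pc (zIter (Istep Pc nb) (IinvStep Pc nb) k g₀).pt = hcpInt) ∧
      zIter (Istep Pc nb) (IinvStep Pc nb) (k + 1) g₀ = Istep Pc nb (zIter (Istep Pc nb) (IinvStep Pc nb) k g₀) := by
  -- one forward step from any admissible frame
  have fwd : ∀ g : ZFrame, IsFrame (Pc g.pt) g.t₁ g.t₂ g.U → g.pt ∈ S → frameParity g.t₁ g.t₂ g.U = 1 →
      ((∀ z ∈ S, Pc z = fcc3Int) ∨ Pc g.pt = hcpInt) →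
      IsFrame (Pc (Istep Pc nb g).pt) (Istep Pc nb g).t₁ (Istep Pc nb g).t₂ (Istep Pc nb g).U ∧
        (Istep Pc nb g).pt ∈ S ∧ frameParity (Istep Pc nb g).t₁ (Istep Pc nb g).t₂ (Istep Pc nb g).U = 1 ∧
        ((∀ z ∈ S, Pc z = fcc3Int) ∨ Pc (Istep Pc nb g).pt = hcpInt) := by
    rintro ⟨x, t₁, t₂, U⟩ hU hx hp hA
    have ht₁ : t₁ ∈ Pc x := hU.2.1 (mem_hexLabels_iff.2 (Or.inl rfl))
    have hreg : Pc (nb x t₁) = fcc3Int ∨ Pc x = hcpInt ∨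
        (-zlab Pc nb (nb x t₁) x ∈ Pc (nb x t₁) ∧ -zlab Pc nb (nb x t₁) (nb x t₂) ∈ Pc (nb x t₁)) := by
      rcases hA with hF | hH
      · exact Or.inl (hF _ (nb_mem hch hx ht₁).1)
      · exact Or.inr (Or.inl hH)
    obtain ⟨hyS, -, -, -, -, -, -, -, -, -, htype, hframe, hpar, -⟩ := Istep_spec hch hx hU hreg
    refine ⟨hframe, hyS, hpar.trans hp, ?_⟩
    rcases hA with hF | hH
    · exact Or.inl hF
    · exact Or.inr (htype hH)
  -- one backward step
  have bwd : ∀ g : ZFrame, IsFrame (Pc g.pt) g.t₁ g.t₂ g.U → g.pt ∈ S → frameParity g.t₁ g.t₂ g.U = 1 →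
      ((∀ z ∈ S, Pc z = fcc3Int) ∨ Pc g.pt = hcpInt) →
      IsFrame (Pc (IinvStep Pc nb g).pt) (IinvStep Pc nb g).t₁ (IinvStep Pc nb g).t₂ (IinvStep Pc nb g).U ∧
        (IinvStep Pc nb g).pt ∈ S ∧ frameParity (IinvStep Pc nb g).t₁ (IinvStep Pc nb g).t₂ (IinvStep Pc nb g).U = 1 ∧
        ((∀ z ∈ S, Pc z = fcc3Int) ∨ Pc (IinvStep Pc nb g).pt = hcpInt) ∧
        Istep Pc nb (IinvStep Pc nb g) = g := by
    rintro ⟨x, t₁, t₂, U⟩ hU hx hp hA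
    have hnt₁ : -t₁ ∈ Pc x := hU.2.1 (mem_hexLabels_iff.2 (Or.inr (Or.inr (Or.inr (Or.inl rfl)))))
    have hreg : Pc (nb x (-t₁)) = fcc3Int ∨ Pc x = hcpInt ∨
        (-zlab Pc nb (nb x (-t₁)) x ∈ Pc (nb x (-t₁)) ∧
          -zlab Pc nb (nb x (-t₁)) (nb x (t₂ - t₁)) ∈ Pc (nb x (-t₁))) := by
      rcases hA with hF | hH
      · exact Or.inl (hF _ (nb_mem hch hx hnt₁).1)
      · exact Or.inr (Or.inl hH)
    obtain ⟨hyS, -, -, -, -, -, -, -, -, -, htype, hframe, hpar, -⟩ := IinvStep_spec hch hx hU hreg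
    refine ⟨hframe, hyS, hpar.trans hp, ?_, Istep_IinvStep hch hx hU hreg⟩
    rcases hA with hF | hH
    · exact Or.inl hF
    · exact Or.inr (htype hH)
  -- naturals
  have hnat : ∀ n : ℕ, IsFrame (Pc (zIter (Istep Pc nb) (IinvStep Pc nb) n g₀).pt)
        (zIter (Istep Pc nb) (IinvStep Pc nb) n g₀).t₁ (zIter (Istep Pc nb) (IinvStep Pc nb) n g₀).t₂
        (zIter (Istep Pc nb) (IinvStep Pc nb) n g₀).U ∧
      (zIter (Istep Pc nb) (IinvStep Pc nb) n g₀).pt ∈ S ∧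
      frameParity (zIter (Istep Pc nb) (IinvStep Pc nb) n g₀).t₁ (zIter (Istep Pc nb) (IinvStep Pc nb) n g₀).t₂
        (zIter (Istep Pc nb) (IinvStep Pc nb) n g₀).U = 1 ∧
      ((∀ z ∈ S, Pc z = fcc3Int) ∨ Pc (zIter (Istep Pc nb) (IinvStep Pc nb) n g₀).pt = hcpInt) := by
    intro n
    induction n with
    | zero => exact ⟨h₀, h₀S, h₀p, h₀A⟩
    | succ m ih =>
      obtain ⟨h1, h2, h3, h4⟩ := ih
      have e : zIter (Istep Pc nb) (IinvStep Pc nb) ((m + 1 : ℕ) : ℤ) g₀ =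
          Istep Pc nb (zIter (Istep Pc nb) (IinvStep Pc nb) m g₀) := by
        push_cast; exact zIter_natSucc _ _ m g₀
      rw [e]; exact fwd _ h1 h2 h3 h4
  -- negatives
  have hneg : ∀ n : ℕ, (IsFrame (Pc (zIter (Istep Pc nb) (IinvStep Pc nb) (-(n : ℤ)) g₀).pt)
        (zIter (Istep Pc nb) (IinvStep Pc nb) (-(n : ℤ)) g₀).t₁ (zIter (Istep Pc nb) (IinvStep Pc nb) (-(n : ℤ)) g₀).t₂
        (zIter (Istep Pc nb) (IinvStep Pc nb) (-(n : ℤ)) g₀).U ∧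
      (zIter (Istep Pc nb) (IinvStep Pc nb) (-(n : ℤ)) g₀).pt ∈ S ∧
      frameParity (zIter (Istep Pc nb) (IinvStep Pc nb) (-(n : ℤ)) g₀).t₁ (zIter (Istep Pc nb) (IinvStep Pc nb) (-(n : ℤ)) g₀).t₂
        (zIter (Istep Pc nb) (IinvStep Pc nb) (-(n : ℤ)) g₀).U = 1 ∧
      ((∀ z ∈ S, Pc z = fcc3Int) ∨ Pc (zIter (Istep Pc nb) (IinvStep Pc nb) (-(n : ℤ)) g₀).pt = hcpInt)) ∧
      zIter (Istep Pc nb) (IinvStep Pc nb) (-(n : ℤ)) g₀ =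
        Istep Pc nb (zIter (Istep Pc nb) (IinvStep Pc nb) (-((n : ℤ) + 1)) g₀) := by
    intro n
    induction n with
    | zero =>
      refine ⟨by simpa using ⟨h₀, h₀S, h₀p, h₀A⟩, ?_⟩
      rw [zIter_negSucc']
      have e : zIter (Istep Pc nb) (IinvStep Pc nb) (-((0 : ℕ) : ℤ)) g₀ = g₀ := rfl
      rw [e]
      exact ((bwd g₀ h₀ h₀S h₀p h₀A).2.2.2.2).symm
    | succ m ih =>
      obtain ⟨⟨h1, h2, h3, h4⟩, -⟩ := ih
      have e : zIter (Istep Pc nb) (IinvStep Pc nb) (-((m + 1 : ℕ) : ℤ)) g₀ =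
          IinvStep Pc nb (zIter (Istep Pc nb) (IinvStep Pc nb) (-(m : ℤ)) g₀) := by
        push_cast; exact zIter_negSucc' _ _ m g₀
      obtain ⟨b1, b2, b3, b4, b5⟩ := bwd _ h1 h2 h3 h4
      refine ⟨by rw [e]; exact ⟨b1, b2, b3, b4⟩, ?_⟩
      have e' : zIter (Istep Pc nb) (IinvStep Pc nb) (-(((m + 1 : ℕ) : ℤ) + 1)) g₀ =
          IinvStep Pc nb (zIter (Istep Pc nb) (IinvStep Pc nb) (-((m + 1 : ℕ) : ℤ)) g₀) :=
        zIter_negSucc' _ _ (m + 1) g₀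
      rw [e', e]
      obtain ⟨-, -, -, -, b5'⟩ := bwd _ b1 b2 b3 b4
      exact b5'.symm
  intro k
  rcases int_cases k with ⟨n, rfl⟩ | ⟨n, rfl⟩
  · obtain ⟨h1, h2, h3, h4⟩ := hnat n
    exact ⟨h1, h2, h3, h4, zIter_natSucc _ _ n g₀⟩
  · obtain ⟨⟨h1, h2, h3, h4⟩, -⟩ := hneg (n + 1)
    obtain ⟨-, hrel⟩ := hneg n
    push_cast at h1 h2 h3 h4 hrel ⊢
    refine ⟨h1, h2, h3, h4, ?_⟩
    rw [show -((n : ℤ) + 1) + 1 = -(n : ℤ) by ring]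
    exact hrel

/-- **The J-line through an admissible frame.**  Iterating `J` / `J⁻¹` from a valid frame of
parity `+1` in the base regime gives valid frames of parity `+1` in the base regime, consecutive
ones related by `J`. [folklore] -/
theorem line_J (hch : ∀ z ∈ S, IsZChart S z (ac z) (Pc z) (Ac z) (nb z)) {g₀ : ZFrame}
    (h₀ : IsFrame (Pc g₀.pt) g₀.t₁ g₀.t₂ g₀.U) (h₀S : g₀.pt ∈ S) (h₀p : frameParity g₀.t₁ g₀.t₂ g₀.U = 1)
    (h₀A : (∀ z ∈ S, Pc z = fcc3Int) ∨ Pc g₀.pt = hcpInt) :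
    ∀ k : ℤ, IsFrame (Pc (zIter (Jstep Pc nb) (JinvStep Pc nb) k g₀).pt) (zIter (Jstep Pc nb) (JinvStep Pc nb) k g₀).t₁
        (zIter (Jstep Pc nb) (JinvStep Pc nb) k g₀).t₂ (zIter (Jstep Pc nb) (JinvStep Pc nb) k g₀).U ∧
      (zIter (Jstep Pc nb) (JinvStep Pc nb) k g₀).pt ∈ S ∧
      frameParity (zIter (Jstep Pc nb) (JinvStep Pc nb) k g₀).t₁ (zIter (Jstep Pc nb) (JinvStep Pc nb) k g₀).t₂
        (zIter (Jstep Pc nb) (JinvStep Pc nb) k g₀).U = 1 ∧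
      ((∀ z ∈ S, Pc z = fcc3Int) ∨ Pc (zIter (Jstep Pc nb) (JinvStep Pc nb) k g₀).pt = hcpInt) ∧
      zIter (Jstep Pc nb) (JinvStep Pc nb) (k + 1) g₀ = Jstep Pc nb (zIter (Jstep Pc nb) (JinvStep Pc nb) k g₀) := by
  -- one forward step from any admissible frame
  have fwd : ∀ g : ZFrame, IsFrame (Pc g.pt) g.t₁ g.t₂ g.U → g.pt ∈ S → frameParity g.t₁ g.t₂ g.U = 1 →
      ((∀ z ∈ S, Pc z = fcc3Int) ∨ Pc g.pt = hcpInt) →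
      IsFrame (Pc (Jstep Pc nb g).pt) (Jstep Pc nb g).t₁ (Jstep Pc nb g).t₂ (Jstep Pc nb g).U ∧
        (Jstep Pc nb g).pt ∈ S ∧ frameParity (Jstep Pc nb g).t₁ (Jstep Pc nb g).t₂ (Jstep Pc nb g).U = 1 ∧
        ((∀ z ∈ S, Pc z = fcc3Int) ∨ Pc (Jstep Pc nb g).pt = hcpInt) := by
    rintro ⟨x, t₁, t₂, U⟩ hU hx hp hA
    have ht₂ : t₂ ∈ Pc x := hU.2.1 (mem_hexLabels_iff.2 (Or.inr (Or.inl rfl)))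
    have hreg : Pc (nb x t₂) = fcc3Int ∨ Pc x = hcpInt ∨
        (-zlab Pc nb (nb x t₂) x ∈ Pc (nb x t₂) ∧ -zlab Pc nb (nb x t₂) (nb x t₁) ∈ Pc (nb x t₂)) := by
      rcases hA with hF | hH
      · exact Or.inl (hF _ (nb_mem hch hx ht₂).1)
      · exact Or.inr (Or.inl hH)
    obtain ⟨hyS, -, -, -, -, -, -, -, -, -, htype, hframe, hpar, -⟩ := Jstep_spec hch hx hU hreg
    refine ⟨hframe, hyS, hpar.trans hp, ?_⟩
    rcases hA with hF | hH
    · exact Or.inl hF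
    · exact Or.inr (htype hH)
  -- one backward step
  have bwd : ∀ g : ZFrame, IsFrame (Pc g.pt) g.t₁ g.t₂ g.U → g.pt ∈ S → frameParity g.t₁ g.t₂ g.U = 1 →
      ((∀ z ∈ S, Pc z = fcc3Int) ∨ Pc g.pt = hcpInt) →
      IsFrame (Pc (JinvStep Pc nb g).pt) (JinvStep Pc nb g).t₁ (JinvStep Pc nb g).t₂ (JinvStep Pc nb g).U ∧
        (JinvStep Pc nb g).pt ∈ S ∧ frameParity (JinvStep Pc nb g).t₁ (JinvStep Pc nb g).t₂ (JinvStep Pc nb g).U = 1 ∧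
        ((∀ z ∈ S, Pc z = fcc3Int) ∨ Pc (JinvStep Pc nb g).pt = hcpInt) ∧
        Jstep Pc nb (JinvStep Pc nb g) = g := by
    rintro ⟨x, t₁, t₂, U⟩ hU hx hp hA
    have hnt₂ : -t₂ ∈ Pc x := hU.2.1 (mem_hexLabels_iff.2 (Or.inr (Or.inr (Or.inr (Or.inr (Or.inl rfl))))))
    have hreg : Pc (nb x (-t₂)) = fcc3Int ∨ Pc x = hcpInt ∨
        (-zlab Pc nb (nb x (-t₂)) x ∈ Pc (nb x (-t₂)) ∧
          -zlab Pc nb (nb x (-t₂)) (nb x (t₁ - t₂)) ∈ Pc (nb x (-t₂))) := by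
      rcases hA with hF | hH
      · exact Or.inl (hF _ (nb_mem hch hx hnt₂).1)
      · exact Or.inr (Or.inl hH)
    obtain ⟨hyS, -, -, -, -, -, -, -, -, -, htype, hframe, hpar, -⟩ := JinvStep_spec hch hx hU hreg
    refine ⟨hframe, hyS, hpar.trans hp, ?_, Jstep_JinvStep hch hx hU hreg⟩
    rcases hA with hF | hH
    · exact Or.inl hF
    · exact Or.inr (htype hH)
  -- naturals
  have hnat : ∀ n : ℕ, IsFrame (Pc (zIter (Jstep Pc nb) (JinvStep Pc nb) n g₀).pt)
        (zIter (Jstep Pc nb) (JinvStep Pc nb) n g₀).t₁ (zIter (Jstep Pc nb) (JinvStep Pc nb) n g₀).t₂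
        (zIter (Jstep Pc nb) (JinvStep Pc nb) n g₀).U ∧
      (zIter (Jstep Pc nb) (JinvStep Pc nb) n g₀).pt ∈ S ∧
      frameParity (zIter (Jstep Pc nb) (JinvStep Pc nb) n g₀).t₁ (zIter (Jstep Pc nb) (JinvStep Pc nb) n g₀).t₂
        (zIter (Jstep Pc nb) (JinvStep Pc nb) n g₀).U = 1 ∧
      ((∀ z ∈ S, Pc z = fcc3Int) ∨ Pc (zIter (Jstep Pc nb) (JinvStep Pc nb) n g₀).pt = hcpInt) := by
    intro n
    induction n with
    | zero => exact ⟨h₀, h₀S, h₀p, h₀A⟩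
    | succ m ih =>
      obtain ⟨h1, h2, h3, h4⟩ := ih
      have e : zIter (Jstep Pc nb) (JinvStep Pc nb) ((m + 1 : ℕ) : ℤ) g₀ =
          Jstep Pc nb (zIter (Jstep Pc nb) (JinvStep Pc nb) m g₀) := by
        push_cast; exact zIter_natSucc _ _ m g₀
      rw [e]; exact fwd _ h1 h2 h3 h4
  -- negatives
  have hneg : ∀ n : ℕ, (IsFrame (Pc (zIter (Jstep Pc nb) (JinvStep Pc nb) (-(n : ℤ)) g₀).pt)
        (zIter (Jstep Pc nb) (JinvStep Pc nb) (-(n : ℤ)) g₀).t₁ (zIter (Jstep Pc nb) (JinvStep Pc nb) (-(n : ℤ)) g₀).t₂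
        (zIter (Jstep Pc nb) (JinvStep Pc nb) (-(n : ℤ)) g₀).U ∧
      (zIter (Jstep Pc nb) (JinvStep Pc nb) (-(n : ℤ)) g₀).pt ∈ S ∧
      frameParity (zIter (Jstep Pc nb) (JinvStep Pc nb) (-(n : ℤ)) g₀).t₁ (zIter (Jstep Pc nb) (JinvStep Pc nb) (-(n : ℤ)) g₀).t₂
        (zIter (Jstep Pc nb) (JinvStep Pc nb) (-(n : ℤ)) g₀).U = 1 ∧
      ((∀ z ∈ S, Pc z = fcc3Int) ∨ Pc (zIter (Jstep Pc nb) (JinvStep Pc nb) (-(n : ℤ)) g₀).pt = hcpInt)) ∧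
      zIter (Jstep Pc nb) (JinvStep Pc nb) (-(n : ℤ)) g₀ =
        Jstep Pc nb (zIter (Jstep Pc nb) (JinvStep Pc nb) (-((n : ℤ) + 1)) g₀) := by
    intro n
    induction n with
    | zero =>
      refine ⟨by simpa using ⟨h₀, h₀S, h₀p, h₀A⟩, ?_⟩
      rw [zIter_negSucc']
      have e : zIter (Jstep Pc nb) (JinvStep Pc nb) (-((0 : ℕ) : ℤ)) g₀ = g₀ := rfl
      rw [e]
      exact ((bwd g₀ h₀ h₀S h₀p h₀A).2.2.2.2).symm
    | succ m ih =>
      obtain ⟨⟨h1, h2, h3, h4⟩, -⟩ := ih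
      have e : zIter (Jstep Pc nb) (JinvStep Pc nb) (-((m + 1 : ℕ) : ℤ)) g₀ =
          JinvStep Pc nb (zIter (Jstep Pc nb) (JinvStep Pc nb) (-(m : ℤ)) g₀) := by
        push_cast; exact zIter_negSucc' _ _ m g₀
      obtain ⟨b1, b2, b3, b4, b5⟩ := bwd _ h1 h2 h3 h4
      refine ⟨by rw [e]; exact ⟨b1, b2, b3, b4⟩, ?_⟩
      have e' : zIter (Jstep Pc nb) (JinvStep Pc nb) (-(((m + 1 : ℕ) : ℤ) + 1)) g₀ =
          JinvStep Pc nb (zIter (Jstep Pc nb) (JinvStep Pc nb) (-((m + 1 : ℕ) : ℤ)) g₀) :=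
        zIter_negSucc' _ _ (m + 1) g₀
      rw [e', e]
      obtain ⟨-, -, -, -, b5'⟩ := bwd _ b1 b2 b3 b4
      exact b5'.symm
  intro k
  rcases int_cases k with ⟨n, rfl⟩ | ⟨n, rfl⟩
  · obtain ⟨h1, h2, h3, h4⟩ := hnat n
    exact ⟨h1, h2, h3, h4, zIter_natSucc _ _ n g₀⟩
  · obtain ⟨⟨h1, h2, h3, h4⟩, -⟩ := hneg (n + 1)
    obtain ⟨-, hrel⟩ := hneg n
    push_cast at h1 h2 h3 h4 hrel ⊢
    refine ⟨h1, h2, h3, h4, ?_⟩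
    rw [show -((n : ℤ) + 1) + 1 = -(n : ℤ) by ring]
    exact hrel

/-- The four in-layer transports of an admissible frame are valid frames (base regime).
[folklore] -/
theorem adm_transports (hch : ∀ z ∈ S, IsZChart S z (ac z) (Pc z) (Ac z) (nb z)) {x : (EuclideanSpace ℝ (Fin 3))} (hx : x ∈ S)
    {t₁ t₂ : Fin 3 → ℤ} {U : Finset (Fin 3 → ℤ)} (hU : IsFrame (Pc x) t₁ t₂ U)
    (hA : (∀ z ∈ S, Pc z = fcc3Int) ∨ Pc x = hcpInt) :
    IsFrame (Pc (nb x t₁)) (Istep Pc nb ⟨x, t₁, t₂, U⟩).t₁ (Istep Pc nb ⟨x, t₁, t₂, U⟩).t₂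
      (Istep Pc nb ⟨x, t₁, t₂, U⟩).U ∧
    IsFrame (Pc (nb x t₂)) (Jstep Pc nb ⟨x, t₁, t₂, U⟩).t₁ (Jstep Pc nb ⟨x, t₁, t₂, U⟩).t₂
      (Jstep Pc nb ⟨x, t₁, t₂, U⟩).U ∧
    IsFrame (Pc (nb x (-t₁))) (IinvStep Pc nb ⟨x, t₁, t₂, U⟩).t₁
      (IinvStep Pc nb ⟨x, t₁, t₂, U⟩).t₂ (IinvStep Pc nb ⟨x, t₁, t₂, U⟩).U ∧
    IsFrame (Pc (nb x (-t₂))) (JinvStep Pc nb ⟨x, t₁, t₂, U⟩).t₁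
      (JinvStep Pc nb ⟨x, t₁, t₂, U⟩).t₂ (JinvStep Pc nb ⟨x, t₁, t₂, U⟩).U ∧
    ((∀ z ∈ S, Pc z = fcc3Int) ∨ Pc (nb x t₂) = hcpInt) := by
  obtain ⟨h12, hhex, -, -, -⟩ := id hU
  have ht₁ : t₁ ∈ Pc x := hhex (mem_hexLabels_iff.2 (Or.inl rfl))
  have ht₂ : t₂ ∈ Pc x := hhex (mem_hexLabels_iff.2 (Or.inr (Or.inl rfl)))
  have hnt₁ : -t₁ ∈ Pc x := hhex (mem_hexLabels_iff.2 (Or.inr (Or.inr (Or.inr (Or.inl rfl)))))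
  have hnt₂ : -t₂ ∈ Pc x := hhex (mem_hexLabels_iff.2 (Or.inr (Or.inr (Or.inr (Or.inr (Or.inl rfl))))))
  have mk : ∀ (y : (EuclideanSpace ℝ (Fin 3))), y ∈ S → ∀ (Q R : Prop), Pc y = fcc3Int ∨ Pc x = hcpInt ∨ (Q ∧ R) := by
    intro y hy Q R
    rcases hA with hF | hH
    · exact Or.inl (hF y hy)
    · exact Or.inr (Or.inl hH)
  obtain ⟨-, -, -, -, -, -, -, -, -, -, -, hI, -⟩ := Istep_spec hch hx hU (mk _ (nb_mem hch hx ht₁).1 _ _)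
  obtain ⟨-, -, -, -, -, -, -, -, -, -, htJ, hJ, -⟩ := Jstep_spec hch hx hU (mk _ (nb_mem hch hx ht₂).1 _ _)
  obtain ⟨-, -, -, -, -, -, -, -, -, -, -, hIi, -⟩ := IinvStep_spec hch hx hU (mk _ (nb_mem hch hx hnt₁).1 _ _)
  obtain ⟨-, -, -, -, -, -, -, -, -, -, -, hJi, -⟩ := JinvStep_spec hch hx hU (mk _ (nb_mem hch hx hnt₂).1 _ _)
  refine ⟨hI, hJ, hIi, hJi, ?_⟩
  rcases hA with hF | hH
  · exact Or.inl hF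
  · exact Or.inr (htJ hH)

/-- **The base layer** `R i j = Iⁱ (Jʲ g₀)` of an admissible frame is valid, coherent along both
directions (the in-layer commutation `Istep_Jstep_comm` at parity `+1`), and of parity `+1`.
[folklore] -/
theorem layer_zero (hch : ∀ z ∈ S, IsZChart S z (ac z) (Pc z) (Ac z) (nb z)) {g₀ : ZFrame}
    (h₀ : IsFrame (Pc g₀.pt) g₀.t₁ g₀.t₂ g₀.U) (h₀S : g₀.pt ∈ S) (h₀p : frameParity g₀.t₁ g₀.t₂ g₀.U = 1)
    (h₀A : (∀ z ∈ S, Pc z = fcc3Int) ∨ Pc g₀.pt = hcpInt) :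
    (∀ i j : ℤ, IsFrame (Pc (zIter (Istep Pc nb) (IinvStep Pc nb) i (zIter (Jstep Pc nb) (JinvStep Pc nb) j g₀)).pt)
        (zIter (Istep Pc nb) (IinvStep Pc nb) i (zIter (Jstep Pc nb) (JinvStep Pc nb) j g₀)).t₁
        (zIter (Istep Pc nb) (IinvStep Pc nb) i (zIter (Jstep Pc nb) (JinvStep Pc nb) j g₀)).t₂
        (zIter (Istep Pc nb) (IinvStep Pc nb) i (zIter (Jstep Pc nb) (JinvStep Pc nb) j g₀)).U) ∧
    (∀ i j : ℤ, (zIter (Istep Pc nb) (IinvStep Pc nb) i (zIter (Jstep Pc nb) (JinvStep Pc nb) j g₀)).pt ∈ S) ∧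
    (∀ i j : ℤ, zIter (Istep Pc nb) (IinvStep Pc nb) (i + 1) (zIter (Jstep Pc nb) (JinvStep Pc nb) j g₀) =
        Istep Pc nb (zIter (Istep Pc nb) (IinvStep Pc nb) i (zIter (Jstep Pc nb) (JinvStep Pc nb) j g₀))) ∧
    (∀ i j : ℤ, zIter (Istep Pc nb) (IinvStep Pc nb) i (zIter (Jstep Pc nb) (JinvStep Pc nb) (j + 1) g₀) =
        Jstep Pc nb (zIter (Istep Pc nb) (IinvStep Pc nb) i (zIter (Jstep Pc nb) (JinvStep Pc nb) j g₀))) ∧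
    (∀ i j : ℤ, frameParity (zIter (Istep Pc nb) (IinvStep Pc nb) i (zIter (Jstep Pc nb) (JinvStep Pc nb) j g₀)).t₁
        (zIter (Istep Pc nb) (IinvStep Pc nb) i (zIter (Jstep Pc nb) (JinvStep Pc nb) j g₀)).t₂
        (zIter (Istep Pc nb) (IinvStep Pc nb) i (zIter (Jstep Pc nb) (JinvStep Pc nb) j g₀)).U = 1) := by
  have col := line_J (Pc := Pc) (nb := nb) hch h₀ h₀S h₀p h₀A
  have row : ∀ j : ℤ, ∀ i : ℤ, _ := fun j =>
    line_I (Pc := Pc) (nb := nb) hch (col j).1 (col j).2.1 (col j).2.2.1 (col j).2.2.2.1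
  refine ⟨fun i j => (row j i).1, fun i j => (row j i).2.1, fun i j => (row j i).2.2.2.2, ?_,
    fun i j => (row j i).2.2.1⟩
  -- coherence along `J`, by induction on `i`
  intro i j
  -- the inductive step upward from an admissible `g`
  have up : ∀ g : ZFrame, IsFrame (Pc g.pt) g.t₁ g.t₂ g.U → g.pt ∈ S → frameParity g.t₁ g.t₂ g.U = 1 →
      ((∀ z ∈ S, Pc z = fcc3Int) ∨ Pc g.pt = hcpInt) →
      Istep Pc nb (Jstep Pc nb g) = Jstep Pc nb (Istep Pc nb g) := by
    rintro ⟨x, t₁, t₂, U⟩ hU hx hp hA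
    obtain ⟨hI, hJ, hIi, hJi, -⟩ := adm_transports hch hx hU hA
    exact Istep_Jstep_comm hch hx hU hp hA hI hJ hIi hJi
  -- and downward: `I⁻¹ (J (I h)) = J h`
  have down : ∀ h : ZFrame, IsFrame (Pc h.pt) h.t₁ h.t₂ h.U → h.pt ∈ S → frameParity h.t₁ h.t₂ h.U = 1 →
      ((∀ z ∈ S, Pc z = fcc3Int) ∨ Pc h.pt = hcpInt) →
      IinvStep Pc nb (Jstep Pc nb (Istep Pc nb h)) = Jstep Pc nb h := by
    rintro ⟨x, t₁, t₂, U⟩ hU hx hp hA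
    obtain ⟨hI, hJ, hIi, hJi, hAJ⟩ := adm_transports hch hx hU hA
    rw [← Istep_Jstep_comm hch hx hU hp hA hI hJ hIi hJi]
    rcases hJeq : Jstep Pc nb ⟨x, t₁, t₂, U⟩ with ⟨y, a, b, W⟩
    have hyS : y ∈ S := by
      have ht₂ : t₂ ∈ Pc x := hU.2.1 (mem_hexLabels_iff.2 (Or.inr (Or.inl rfl)))
      have := (nb_mem hch hx ht₂).1
      rw [show nb x t₂ = y from congrArg ZFrame.pt hJeq] at this; exact this
    have hW : IsFrame (Pc y) a b W := by
      rw [hJeq, show nb x t₂ = y from congrArg ZFrame.pt hJeq] at hJ; exact hJ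
    have hAy : (∀ z ∈ S, Pc z = fcc3Int) ∨ Pc y = hcpInt := by
      rw [show nb x t₂ = y from congrArg ZFrame.pt hJeq] at hAJ; exact hAJ
    obtain ⟨hI', -, -, -, -⟩ := adm_transports hch hyS hW hAy
    exact IinvStep_Istep hch hyS hW (hregI_of_valid (Pc := Pc) (nb := nb) hI')
  have hnat : ∀ n : ℕ, zIter (Istep Pc nb) (IinvStep Pc nb) (n : ℤ) (zIter (Jstep Pc nb) (JinvStep Pc nb) (j + 1) g₀) =
      Jstep Pc nb (zIter (Istep Pc nb) (IinvStep Pc nb) (n : ℤ) (zIter (Jstep Pc nb) (JinvStep Pc nb) j g₀)) := by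
    intro n
    induction n with
    | zero => exact (col j).2.2.2.2
    | succ m ih =>
      push_cast
      rw [zIter_natSucc, zIter_natSucc, ih]
      obtain ⟨h1, h2, h3, h4, -⟩ := row j m
      exact up _ h1 h2 h3 h4
  have hneg : ∀ m : ℕ, zIter (Istep Pc nb) (IinvStep Pc nb) (-(m : ℤ)) (zIter (Jstep Pc nb) (JinvStep Pc nb) (j + 1) g₀) =
      Jstep Pc nb (zIter (Istep Pc nb) (IinvStep Pc nb) (-(m : ℤ)) (zIter (Jstep Pc nb) (JinvStep Pc nb) j g₀)) := by
    intro m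
    induction m with
    | zero => simpa using hnat 0
    | succ m ih =>
      push_cast
      rw [zIter_negSucc', ih]
      obtain ⟨h1, h2, h3, h4, hrel⟩ := row j (-((m : ℤ) + 1))
      rw [show -((m : ℤ) + 1) + 1 = -(m : ℤ) by ring] at hrel
      rw [hrel]
      exact down _ h1 h2 h3 h4
  rcases int_cases i with ⟨n, rfl⟩ | ⟨n, rfl⟩
  · exact hnat n
  · have := hneg (n + 1); push_cast at this; exact this

end Summit.AtomisticToContinuum.Crystallization.Theorems.PalmUnimodularRigidityShellsToBarlowChart

end
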